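import Mathlib
import Summits.Ventures.PercRepro2.LocRows
import Summits.Ventures.PercRepro2.LocRows2
import Summits.Ventures.PercRepro2.LocSym

/-!
# The MONOTONE form of the principal local injection: row (LOC0-mono)
(blind cell PercRepro2, night-4 g2; census 2026-08-24T03:2xZ–04:0xZ, own code mining/night-4/g2/,
proofs/NIGHT4-MONO.md §1)

`(LOC0)` asks for an injection `M₀ = {h ∉ H_l, o ∈ B_side} → P₀ = {h ∉ H_l, o ∈ R_side}` that recolours
only edges touching the blue cluster `C_B(l)` of the source.  The census of this seat shows that the
injection can be taken MONOTONE and NESTED: inside `C_B(l)(ζ)` red edges are only ADDED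
(`ζ ≤ ψ ζ` on `within (C_B(l))`), the boundary edges of `C_B(l)` (all red in the source) may only
turn blue, the blue cluster of the image lies inside the blue cluster of the source, and no vertex
is released (every vertex of `C_B(l)(ζ)` that is not in `C_B(l)(ψ ζ)` lies in `C_R(l)(ψ ζ)`).
`LocMono` is that statement; `locU_of_locMono` is its reduction to `(LOC-𝓤)` at the principal up-set
(hence to 2′DOM2 and (BASE) on every fibre through the landed ladder `LocUDom2` / `HullDom`).

Census (exact, Kuhn matching on the constrained bipartite graph): `LocMono` holds in ALL 460 `(l, h, o)`
cases at `n = 5` and ALL 5,633 cases at `n = 6` (all connected graphs, every marking with `M₀ ≠ ∅`);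
`n = 7` on kit (j212671 …).  Sharper forms FALSE: + `hull (ψ ζ) ⊆ hull ζ` (17 / 5,633); + every red edge
inside `C_R(l)(ζ)` kept (200 / 5,633); + changed edges inside `touches (piece ζ l o)` (419 / 5,633);
+ `C_B(l)(ψ ζ) = C₀` (2,384 / 5,633).  Statement and reduction only.
-/

namespace Summit.Ventures.PercRepro2

namespace LocRows

open Hull

variable {V : Type*} {E : Type*} [Fintype E] [DecidableEq E]

open scoped Classical

variable (ends : E → Sym2 V)

/-- `ζ'` only ADDS red edges inside the vertex set `S`: every edge inside `S` that is red in `ζ` is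
red in `ζ'`. -/
def MonoWithin (S : Set V) (ζ ζ' : Config E) : Prop :=
  ∀ e, e ∈ within ends S → ζ e = true → ζ' e = true

/-- **Row (LOC0-mono)**: an injection `M₀ → P₀` which (i) recolours only edges touching the blue
cluster `C_B(l)` of the source, (ii) only adds red edges inside `C_B(l)`, (iii) has its blue cluster
inside the source's, and (iv) releases no vertex: a vertex of the source's blue cluster that leaves
the blue cluster joins the red cluster of the image. -/
def LocMono (l h o : V) : Prop :=
  ∃ f : {ζ // ζ ∈ srcU ends l h {S : Set V | o ∈ S}} → Config E, Function.Injective f ∧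
    ∀ x, f x ∈ tgtU ends l h {S : Set V | o ∈ S} ∧
      LocalAtSet ends (fun ζ => cluster ends (blue ζ) l) x.1 (f x) ∧
      MonoWithin ends (cluster ends (blue x.1) l) x.1 (f x) ∧
      cluster ends (blue (f x)) l ⊆ cluster ends (blue x.1) l ∧
      cluster ends (blue x.1) l \ cluster ends (blue (f x)) l ⊆ cluster ends (f x) l

/-- (LOC0-mono) ⟹ (LOC-𝓤) at the principal up-set. -/
theorem locU_of_locMono (l h o : V) (hm : LocMono ends l h o) :
    LocU ends l h {S : Set V | o ∈ S} := by
  obtain ⟨f, hf, hmem⟩ := hm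
  exact ⟨f, hf, fun x => ⟨(hmem x).1, (hmem x).2.1⟩⟩

/-- (LOC0-mono) over all finite graphs and markings. -/
def LocMono_all : Prop :=
  ∀ (V E : Type) [Fintype V] [DecidableEq V] [Fintype E] [DecidableEq E] (ends : E → Sym2 V)
    (l h o : V), l ≠ h → o ≠ l → o ≠ h → LocMono ends l h o

omit [Fintype E] [DecidableEq E] in
/-- The boundary clause is automatic: an edge from the blue cluster of `l` to a vertex outside it is
red (in any configuration), so "boundary edges of `C_B(l)` may only turn blue" needs no clause in
`LocMono` — the row reads "local, monotone inside, nested, no release". -/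
lemma red_of_mem_cluster_blue_of_notMem {l : V} {ζ : Config E} {e : E} {x y : V}
    (hx : x ∈ cluster ends (blue ζ) l) (hy : y ∉ cluster ends (blue ζ) l) (hends : ends e = s(x, y)) :
    ζ e = true := by
  by_contra hred
  have hb : blue ζ e = true := by
    simp [blue, Bool.eq_false_iff.2 hred]
  exact hy (mem_cluster_of_edge hx hb hends)

end LocRows

end Summit.Ventures.PercRepro2
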